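import Mathlib
import HarnessLib
import Summits.HubbardSuperconductivity.HubbardSuperconductivity.Theorems.KLProgrammeKLRegimeSectorSliceIncrPairMoment
import Summits.HubbardSuperconductivity.HubbardSuperconductivity.Theorems.KLProgrammeKLRegimeSectorSlicePairSectional

/-!
# K3 VL child `KLRegimeVolumeLimitV17F2` (stmt-HubbardSuperconductivity-20440), located item #23 «W2-HALF-VL» / «W2H-SEC-COV», brick 1: the per-pair
# SECTIONAL (fixed-time, spatially weighted) bound of the INCREMENT `Sᵀ(F)·(C^{K′}_{(Λ,Λ′]} − C^K_{(Λ,Λ′]})·S(F)` between two frames, from multiplier data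

Cell `gate-hubbard-kl`, seat p3 (g13), lead of #23.  The fixed-time twin of k3c3-p2's `sliceIncrPairWt_charSum_l1_le` (`…SectorSliceIncrPairMoment`): SAME
multiplier data (spatial differences, no time differences), SAME band-increment data (`P₀ … P₃`, `Kb₁ … Kb₃`, cutoff `B₁ … B₄`), SAME four spatial rate
inequalities `hr₁ hr₂ hr₃ hr₃′` (the time one `hr₀` and the level condition `Λ′ < π(2M−5)/β` are not needed), support count replaced by the two SECTION
counts `Nt`, `Nsp`; the core is p3 g11's `sliceCharSumWt_sectional_le_of_mixed_data` (`…SectorSlicePairSectional`) instead of `sliceCharSumWt_l1_le_of_mixed_data`.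
Result, for EVERY time difference `z₁`: `Σ_{z₂} (1 + s₁|z̃₂|₁)·‖Σ_q χχ • (βL²)⁻²(M·ΨΔ)(q)‖ ≤ Nt·(√(…)·√(24·L²·Nsp)·A₀)` — ε-FREE.  Next bricks: the two-scale
form (twin of `…SectorSliceIncrScaleForm`) and the fat-pair instance (twin of k3c4-p2's `…SectorSliceDefectPairFat`) = the input `hT` of
`secRowWt_sliceCT_covSub_le` (p603183) for the sectional COVARIANCE piece of the #23 telescope.

* **`sliceIncrPairWt_charSum_sectional_le`**.

Everything is proved; no definitions; nothing asserts any stub, K3, VL or superconductivity. [cite: BenfattoGiulianiMastropietro2006, §2.8 (2.81), §3 (3.2)–(3.8)]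
-/

noncomputable section

namespace Summit.HubbardSuperconductivity.HubbardSuperconductivity.Theorems.TorusFourierL2

set_option linter.dupNamespace false -- summit = problem name (single-conjunct summit), D-0017

open Finset Complex Literature.MathematicalPhysics.QuantumLattice Literature.Probability.LatticeModels
open Summit.HubbardSuperconductivity.HubbardSuperconductivity.Theorems.DispersionFlow
open scoped Real

section Pair

variable {L M : ℕ} [NeZero L] [NeZero M]

set_option maxHeartbeats 800000 in
/-- **The per-pair SECTIONAL bound of the covariance increment from multiplier data** (see the module docstring; fixed-time twin of
`sliceIncrPairWt_charSum_l1_le`). [cite: BenfattoGiulianiMastropietro2006, §2.8 (2.81), §3 (3.2)–(3.8)] -/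
theorem sliceIncrPairWt_charSum_sectional_le {β μ Λ Λ' : ℝ} {K K' : TrigPolyC4v} (hβ : 0 < β) (hΛ : 0 < Λ) (hΛΛ' : Λ ≤ Λ')
    {Kb₁ Kb₂ Kb₃ : ℝ} (hb₁ : ∀ p, ‖fderiv ℝ (frameLevel μ K) p‖ ≤ Kb₁) (hb₂ : ∀ p, ‖iteratedFDeriv ℝ 2 (frameLevel μ K) p‖ ≤ Kb₂)
    (hb₃ : ∀ p, ‖iteratedFDeriv ℝ 3 (frameLevel μ K) p‖ ≤ Kb₃)
    {P₀ P₁ P₂ P₃ : ℝ} (hv₀ : ∀ p, |frameLevel μ K' p - frameLevel μ K p| ≤ P₀)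
    (hv₁ : ∀ p, ‖fderiv ℝ (fun p => frameLevel μ K' p - frameLevel μ K p) p‖ ≤ P₁)
    (hv₂ : ∀ p, ‖iteratedFDeriv ℝ 2 (fun p => frameLevel μ K' p - frameLevel μ K p) p‖ ≤ P₂)
    (hv₃ : ∀ p, ‖iteratedFDeriv ℝ 3 (fun p => frameLevel μ K' p - frameLevel μ K p) p‖ ≤ P₃)
    {B₁ B₂ B₃ B₄ : ℝ} (hB₁ : ∀ x, |deriv salmhoferCutoff x| ≤ B₁) (hB₂ : ∀ x, |deriv (deriv salmhoferCutoff) x| ≤ B₂)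
    (hB₃ : ∀ x, |deriv (deriv (deriv salmhoferCutoff)) x| ≤ B₃) (hB₄ : ∀ x, |deriv (deriv (deriv (deriv salmhoferCutoff))) x| ≤ B₄)
    -- multiplier data
    (Mf : TorusSite 1 (2 * M) × TorusSite 2 L → ℂ) (hM0 : ∀ q, ‖Mf q‖ ≤ 1)
    (v : Fin 2 → ℤ) (hv : v ≠ 0) {R₀ : ℕ} (hR₀ : 2 * (|v 0| + |v 1|) * (R₀ : ℤ) < L)
    {Nt Nsp : ℕ} (hsuppT : (univ.filter fun q₁ : TorusSite 1 (2 * M) => ∃ k, Mf (q₁, k) ≠ 0).card ≤ Nt)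
    (hsuppS : ∀ q₁ : TorusSite 1 (2 * M), (univ.filter fun k : TorusSite 2 L => Mf (q₁, k) ≠ 0).card ≤ Nsp)
    (ae₁ ae₂ ae₃ : Fin 2 → ℝ) (hae₁ : ∀ i, 0 ≤ ae₁ i) (hae₂ : ∀ i, 0 ≤ ae₂ i) (hae₃ : ∀ i, 0 ≤ ae₃ i)
    (hMe₁ : ∀ q (i : Fin 2), ‖fwdDiff ((0 : TorusSite 1 (2 * M)), (Pi.single i (1 : ZMod L) : TorusSite 2 L)) Mf q‖ ≤ ae₁ i)
    (hMe₂ : ∀ q (i : Fin 2), ‖(fwdDiff ((0 : TorusSite 1 (2 * M)), (Pi.single i (1 : ZMod L) : TorusSite 2 L)))^[2] Mf q‖ ≤ ae₂ i)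
    (hMe₃ : ∀ q (i : Fin 2), ‖(fwdDiff ((0 : TorusSite 1 (2 * M)), (Pi.single i (1 : ZMod L) : TorusSite 2 L)))^[3] Mf q‖ ≤ ae₃ i)
    {an₁ an₂ an₃ : ℝ} (han₁ : 0 ≤ an₁) (han₂ : 0 ≤ an₂) (han₃ : 0 ≤ an₃)
    (hMn₁ : ∀ q, ‖fwdDiff ((0 : TorusSite 1 (2 * M)), (fun j => ((![-v 1, v 0] j : ℤ) : ZMod L))) Mf q‖ ≤ an₁)
    (hMn₂ : ∀ q, ‖(fwdDiff ((0 : TorusSite 1 (2 * M)), (fun j => ((![-v 1, v 0] j : ℤ) : ZMod L))))^[2] Mf q‖ ≤ an₂)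
    (hMn₃ : ∀ q, ‖(fwdDiff ((0 : TorusSite 1 (2 * M)), (fun j => ((![-v 1, v 0] j : ℤ) : ZMod L))))^[3] Mf q‖ ≤ an₃)
    {av₁ av₂ av₃ : ℝ} (hav₁ : 0 ≤ av₁) (hav₂ : 0 ≤ av₂) (hav₃ : 0 ≤ av₃)
    (hMv₁ : ∀ q, ‖fwdDiff ((0 : TorusSite 1 (2 * M)), (fun j => ((v j : ℤ) : ZMod L))) Mf q‖ ≤ av₁)
    (hMv₂ : ∀ q, ‖(fwdDiff ((0 : TorusSite 1 (2 * M)), (fun j => ((v j : ℤ) : ZMod L))))^[2] Mf q‖ ≤ av₂)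
    (hMv₃ : ∀ q, ‖(fwdDiff ((0 : TorusSite 1 (2 * M)), (fun j => ((v j : ℤ) : ZMod L))))^[3] Mf q‖ ≤ av₃)
    -- amplitude, rates and the six inequalities (`c = βL²`, `w_r = toLp ((2π/L)·r)`)
    {A₀ : ℝ} (hA : (1 / (β * (L : ℝ) ^ 2)) ^ 2 * ((16 * B₁ + 16) * (β * (L : ℝ) ^ 2) / Λ ^ 2 * P₀) ≤ A₀)
    {s₀ s₁ s₂ s₃ s₃' : ℝ} (hs₀ : 0 < s₀) (hs₁ : 0 < s₁) (hs₂ : 0 < s₂) (hs₃ : 0 < s₃) (hs₃' : 0 < s₃')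
    (hr₁ : ∀ i : Fin 2, (1 / (β * (L : ℝ) ^ 2)) ^ 2 *
        (1 * ((128 * B₄ + 1408 * B₃ + 7776 * B₂ + 27648 * B₁ + 24576) * (β * (L : ℝ) ^ 2) / Λ ^ 5 * P₀ * (Kb₁ * ‖(WithLp.toLp 2 (fun j => 2 * π / L * ((Pi.single i (1 : ℤ) : Fin 2 → ℤ) j : ℝ)) : EuclideanSpace ℝ (Fin 2))‖ + P₁ * ‖(WithLp.toLp 2 (fun j => 2 * π / L * ((Pi.single i (1 : ℤ) : Fin 2 → ℤ) j : ℝ)) : EuclideanSpace ℝ (Fin 2))‖) ^ 3 +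
        (64 * B₃ + 480 * B₂ + 1728 * B₁ + 1536) * (β * (L : ℝ) ^ 2) / Λ ^ 4 *
          (P₁ * ‖(WithLp.toLp 2 (fun j => 2 * π / L * ((Pi.single i (1 : ℤ) : Fin 2 → ℤ) j : ℝ)) : EuclideanSpace ℝ (Fin 2))‖ * (3 * (Kb₁ * ‖(WithLp.toLp 2 (fun j => 2 * π / L * ((Pi.single i (1 : ℤ) : Fin 2 → ℤ) j : ℝ)) : EuclideanSpace ℝ (Fin 2))‖) ^ 2 + 3 * (Kb₁ * ‖(WithLp.toLp 2 (fun j => 2 * π / L * ((Pi.single i (1 : ℤ) : Fin 2 → ℤ) j : ℝ)) : EuclideanSpace ℝ (Fin 2))‖) * (P₁ * ‖(WithLp.toLp 2 (fun j => 2 * π / L * ((Pi.single i (1 : ℤ) : Fin 2 → ℤ) j : ℝ)) : EuclideanSpace ℝ (Fin 2))‖) + (P₁ * ‖(WithLp.toLp 2 (fun j => 2 * π / L * ((Pi.single i (1 : ℤ) : Fin 2 → ℤ) j : ℝ)) : EuclideanSpace ℝ (Fin 2))‖) ^ 2)) +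
        3 * ((64 * B₃ + 480 * B₂ + 1728 * B₁ + 1536) * (β * (L : ℝ) ^ 2) / Λ ^ 4 * P₀ *
            ((Kb₁ * ‖(WithLp.toLp 2 (fun j => 2 * π / L * ((Pi.single i (1 : ℤ) : Fin 2 → ℤ) j : ℝ)) : EuclideanSpace ℝ (Fin 2))‖ + P₁ * ‖(WithLp.toLp 2 (fun j => 2 * π / L * ((Pi.single i (1 : ℤ) : Fin 2 → ℤ) j : ℝ)) : EuclideanSpace ℝ (Fin 2))‖) * (Kb₂ * ‖(WithLp.toLp 2 (fun j => 2 * π / L * ((Pi.single i (1 : ℤ) : Fin 2 → ℤ) j : ℝ)) : EuclideanSpace ℝ (Fin 2))‖ ^ 2 + P₂ * ‖(WithLp.toLp 2 (fun j => 2 * π / L * ((Pi.single i (1 : ℤ) : Fin 2 → ℤ) j : ℝ)) : EuclideanSpace ℝ (Fin 2))‖ ^ 2)) +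
          (32 * B₂ + 144 * B₁ + 128) * (β * (L : ℝ) ^ 2) / Λ ^ 3 *
            (Kb₁ * ‖(WithLp.toLp 2 (fun j => 2 * π / L * ((Pi.single i (1 : ℤ) : Fin 2 → ℤ) j : ℝ)) : EuclideanSpace ℝ (Fin 2))‖ * (P₂ * ‖(WithLp.toLp 2 (fun j => 2 * π / L * ((Pi.single i (1 : ℤ) : Fin 2 → ℤ) j : ℝ)) : EuclideanSpace ℝ (Fin 2))‖ ^ 2) + P₁ * ‖(WithLp.toLp 2 (fun j => 2 * π / L * ((Pi.single i (1 : ℤ) : Fin 2 → ℤ) j : ℝ)) : EuclideanSpace ℝ (Fin 2))‖ * (Kb₂ * ‖(WithLp.toLp 2 (fun j => 2 * π / L * ((Pi.single i (1 : ℤ) : Fin 2 → ℤ) j : ℝ)) : EuclideanSpace ℝ (Fin 2))‖ ^ 2) + P₁ * ‖(WithLp.toLp 2 (fun j => 2 * π / L * ((Pi.single i (1 : ℤ) : Fin 2 → ℤ) j : ℝ)) : EuclideanSpace ℝ (Fin 2))‖ * (P₂ * ‖(WithLp.toLp 2 (fun j => 2 * π / L * ((Pi.single i (1 : ℤ) :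 Fin 2 → ℤ) j : ℝ)) : EuclideanSpace ℝ (Fin 2))‖ ^ 2))) +
        ((32 * B₂ + 144 * B₁ + 128) * (β * (L : ℝ) ^ 2) / Λ ^ 3 * P₀ * (Kb₃ * ‖(WithLp.toLp 2 (fun j => 2 * π / L * ((Pi.single i (1 : ℤ) : Fin 2 → ℤ) j : ℝ)) : EuclideanSpace ℝ (Fin 2))‖ ^ 3 + P₃ * ‖(WithLp.toLp 2 (fun j => 2 * π / L * ((Pi.single i (1 : ℤ) : Fin 2 → ℤ) j : ℝ)) : EuclideanSpace ℝ (Fin 2))‖ ^ 3) +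
          (16 * B₁ + 16) * (β * (L : ℝ) ^ 2) / Λ ^ 2 * (P₃ * ‖(WithLp.toLp 2 (fun j => 2 * π / L * ((Pi.single i (1 : ℤ) : Fin 2 → ℤ) j : ℝ)) : EuclideanSpace ℝ (Fin 2))‖ ^ 3))) +
          3 * (ae₁ i * ((64 * B₃ + 480 * B₂ + 1728 * B₁ + 1536) * (β * (L : ℝ) ^ 2) / Λ ^ 4 * P₀ * (Kb₁ * ‖(WithLp.toLp 2 (fun j => 2 * π / L * ((Pi.single i (1 : ℤ) : Fin 2 → ℤ) j : ℝ)) : EuclideanSpace ℝ (Fin 2))‖ + P₁ * ‖(WithLp.toLp 2 (fun j => 2 * π / L * ((Pi.single i (1 : ℤ) : Fin 2 → ℤ) j : ℝ)) : EuclideanSpace ℝ (Fin 2))‖) ^ 2 +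
        (32 * B₂ + 144 * B₁ + 128) * (β * (L : ℝ) ^ 2) / Λ ^ 3 * (P₁ * ‖(WithLp.toLp 2 (fun j => 2 * π / L * ((Pi.single i (1 : ℤ) : Fin 2 → ℤ) j : ℝ)) : EuclideanSpace ℝ (Fin 2))‖ * (2 * (Kb₁ * ‖(WithLp.toLp 2 (fun j => 2 * π / L * ((Pi.single i (1 : ℤ) : Fin 2 → ℤ) j : ℝ)) : EuclideanSpace ℝ (Fin 2))‖) + P₁ * ‖(WithLp.toLp 2 (fun j => 2 * π / L * ((Pi.single i (1 : ℤ) : Fin 2 → ℤ) j : ℝ)) : EuclideanSpace ℝ (Fin 2))‖)) +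
        ((32 * B₂ + 144 * B₁ + 128) * (β * (L : ℝ) ^ 2) / Λ ^ 3 * P₀ * (Kb₂ * ‖(WithLp.toLp 2 (fun j => 2 * π / L * ((Pi.single i (1 : ℤ) : Fin 2 → ℤ) j : ℝ)) : EuclideanSpace ℝ (Fin 2))‖ ^ 2 + P₂ * ‖(WithLp.toLp 2 (fun j => 2 * π / L * ((Pi.single i (1 : ℤ) : Fin 2 → ℤ) j : ℝ)) : EuclideanSpace ℝ (Fin 2))‖ ^ 2) +
          (16 * B₁ + 16) * (β * (L : ℝ) ^ 2) / Λ ^ 2 * (P₂ * ‖(WithLp.toLp 2 (fun j => 2 * π / L * ((Pi.single i (1 : ℤ) : Fin 2 → ℤ) j : ℝ)) : EuclideanSpace ℝ (Fin 2))‖ ^ 2)))) +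
          3 * (ae₂ i * ((32 * B₂ + 144 * B₁ + 128) * (β * (L : ℝ) ^ 2) / Λ ^ 3 * P₀ * (Kb₁ * ‖(WithLp.toLp 2 (fun j => 2 * π / L * ((Pi.single i (1 : ℤ) : Fin 2 → ℤ) j : ℝ)) : EuclideanSpace ℝ (Fin 2))‖ + P₁ * ‖(WithLp.toLp 2 (fun j => 2 * π / L * ((Pi.single i (1 : ℤ) : Fin 2 → ℤ) j : ℝ)) : EuclideanSpace ℝ (Fin 2))‖) + (16 * B₁ + 16) * (β * (L : ℝ) ^ 2) / Λ ^ 2 * (P₁ * ‖(WithLp.toLp 2 (fun j => 2 * π / L * ((Pi.single i (1 : ℤ) : Fin 2 → ℤ) j : ℝ)) : EuclideanSpace ℝ (Fin 2))‖))) +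
          ae₃ i * ((16 * B₁ + 16) * (β * (L : ℝ) ^ 2) / Λ ^ 2 * P₀)) ≤
      A₀ * (4 / (s₁ * L)) ^ 3)
    (hr₂ : (1 / (β * (L : ℝ) ^ 2)) ^ 2 *
        (1 * ((128 * B₄ + 1408 * B₃ + 7776 * B₂ + 27648 * B₁ + 24576) * (β * (L : ℝ) ^ 2) / Λ ^ 5 * P₀ * (Kb₁ * ‖(WithLp.toLp 2 (fun j => 2 * π / L * ((![-v 1, v 0] : Fin 2 → ℤ) j : ℝ)) : EuclideanSpace ℝ (Fin 2))‖ + P₁ * ‖(WithLp.toLp 2 (fun j => 2 * π / L * ((![-v 1, v 0] : Fin 2 → ℤ) j : ℝ)) : EuclideanSpace ℝ (Fin 2))‖) ^ 3 +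
        (64 * B₃ + 480 * B₂ + 1728 * B₁ + 1536) * (β * (L : ℝ) ^ 2) / Λ ^ 4 *
          (P₁ * ‖(WithLp.toLp 2 (fun j => 2 * π / L * ((![-v 1, v 0] : Fin 2 → ℤ) j : ℝ)) : EuclideanSpace ℝ (Fin 2))‖ * (3 * (Kb₁ * ‖(WithLp.toLp 2 (fun j => 2 * π / L * ((![-v 1, v 0] : Fin 2 → ℤ) j : ℝ)) : EuclideanSpace ℝ (Fin 2))‖) ^ 2 + 3 * (Kb₁ * ‖(WithLp.toLp 2 (fun j => 2 * π / L * ((![-v 1, v 0] : Fin 2 → ℤ) j : ℝ)) : EuclideanSpace ℝ (Fin 2))‖) * (P₁ * ‖(WithLp.toLp 2 (fun j => 2 * π / L * ((![-v 1, v 0] : Fin 2 → ℤ) j : ℝ)) : EuclideanSpace ℝ (Fin 2))‖) + (P₁ * ‖(WithLp.toLp 2 (fun j => 2 * π / L * ((![-v 1, v 0] : Fin 2 → ℤ) j : ℝ)) : EuclideanSpace ℝ (Fin 2))‖) ^ 2)) +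
        3 * ((64 * B₃ + 480 * B₂ + 1728 * B₁ + 1536) * (β * (L : ℝ) ^ 2) / Λ ^ 4 * P₀ *
            ((Kb₁ * ‖(WithLp.toLp 2 (fun j => 2 * π / L * ((![-v 1, v 0] : Fin 2 → ℤ) j : ℝ)) : EuclideanSpace ℝ (Fin 2))‖ + P₁ * ‖(WithLp.toLp 2 (fun j => 2 * π / L * ((![-v 1, v 0] : Fin 2 → ℤ) j : ℝ)) : EuclideanSpace ℝ (Fin 2))‖) * (Kb₂ * ‖(WithLp.toLp 2 (fun j => 2 * π / L * ((![-v 1, v 0] : Fin 2 → ℤ) j : ℝ)) : EuclideanSpace ℝ (Fin 2))‖ ^ 2 + P₂ * ‖(WithLp.toLp 2 (fun j => 2 * π / L * ((![-v 1, v 0] : Fin 2 → ℤ) j : ℝ)) : EuclideanSpace ℝ (Fin 2))‖ ^ 2)) +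
          (32 * B₂ + 144 * B₁ + 128) * (β * (L : ℝ) ^ 2) / Λ ^ 3 *
            (Kb₁ * ‖(WithLp.toLp 2 (fun j => 2 * π / L * ((![-v 1, v 0] : Fin 2 → ℤ) j : ℝ)) : EuclideanSpace ℝ (Fin 2))‖ * (P₂ * ‖(WithLp.toLp 2 (fun j => 2 * π / L * ((![-v 1, v 0] : Fin 2 → ℤ) j : ℝ)) : EuclideanSpace ℝ (Fin 2))‖ ^ 2) + P₁ * ‖(WithLp.toLp 2 (fun j => 2 * π / L * ((![-v 1, v 0] : Fin 2 → ℤ) j : ℝ)) : EuclideanSpace ℝ (Fin 2))‖ * (Kb₂ * ‖(WithLp.toLp 2 (fun j => 2 * π / L * ((![-v 1, v 0] : Fin 2 → ℤ) j : ℝ)) : EuclideanSpace ℝ (Fin 2))‖ ^ 2) + P₁ * ‖(WithLp.toLp 2 (fun j => 2 * π / L * ((![-v 1, v 0] : Fin 2 → ℤ) j : ℝ)) : EuclideanSpace ℝ (Fin 2))‖ * (P₂ * ‖(WithLp.toLp 2 (fun j => 2 * π / L * ((![-v 1, v 0] : Fin 2 → ℤ) j : ℝ)) : EuclideanSpace ℝ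 (Fin 2))‖ ^ 2))) +
        ((32 * B₂ + 144 * B₁ + 128) * (β * (L : ℝ) ^ 2) / Λ ^ 3 * P₀ * (Kb₃ * ‖(WithLp.toLp 2 (fun j => 2 * π / L * ((![-v 1, v 0] : Fin 2 → ℤ) j : ℝ)) : EuclideanSpace ℝ (Fin 2))‖ ^ 3 + P₃ * ‖(WithLp.toLp 2 (fun j => 2 * π / L * ((![-v 1, v 0] : Fin 2 → ℤ) j : ℝ)) : EuclideanSpace ℝ (Fin 2))‖ ^ 3) +
          (16 * B₁ + 16) * (β * (L : ℝ) ^ 2) / Λ ^ 2 * (P₃ * ‖(WithLp.toLp 2 (fun j => 2 * π / L * ((![-v 1, v 0] : Fin 2 → ℤ) j : ℝ)) : EuclideanSpace ℝ (Fin 2))‖ ^ 3))) +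
          3 * (an₁ * ((64 * B₃ + 480 * B₂ + 1728 * B₁ + 1536) * (β * (L : ℝ) ^ 2) / Λ ^ 4 * P₀ * (Kb₁ * ‖(WithLp.toLp 2 (fun j => 2 * π / L * ((![-v 1, v 0] : Fin 2 → ℤ) j : ℝ)) : EuclideanSpace ℝ (Fin 2))‖ + P₁ * ‖(WithLp.toLp 2 (fun j => 2 * π / L * ((![-v 1, v 0] : Fin 2 → ℤ) j : ℝ)) : EuclideanSpace ℝ (Fin 2))‖) ^ 2 +
        (32 * B₂ + 144 * B₁ + 128) * (β * (L : ℝ) ^ 2) / Λ ^ 3 * (P₁ * ‖(WithLp.toLp 2 (fun j => 2 * π / L * ((![-v 1, v 0] : Fin 2 → ℤ) j : ℝ)) : EuclideanSpace ℝ (Fin 2))‖ * (2 * (Kb₁ * ‖(WithLp.toLp 2 (fun j => 2 * π / L * ((![-v 1, v 0] : Fin 2 → ℤ) j : ℝ)) : EuclideanSpace ℝ (Fin 2))‖) + P₁ * ‖(WithLp.toLp 2 (fun j => 2 * π / L * ((![-v 1, v 0] : Fin 2 → ℤ) j : ℝ)) : EuclideanSpace ℝ (Fin 2))‖)) +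
        ((32 * B₂ + 144 * B₁ + 128) * (β * (L : ℝ) ^ 2) / Λ ^ 3 * P₀ * (Kb₂ * ‖(WithLp.toLp 2 (fun j => 2 * π / L * ((![-v 1, v 0] : Fin 2 → ℤ) j : ℝ)) : EuclideanSpace ℝ (Fin 2))‖ ^ 2 + P₂ * ‖(WithLp.toLp 2 (fun j => 2 * π / L * ((![-v 1, v 0] : Fin 2 → ℤ) j : ℝ)) : EuclideanSpace ℝ (Fin 2))‖ ^ 2) +
          (16 * B₁ + 16) * (β * (L : ℝ) ^ 2) / Λ ^ 2 * (P₂ * ‖(WithLp.toLp 2 (fun j => 2 * π / L * ((![-v 1, v 0] : Fin 2 → ℤ) j : ℝ)) : EuclideanSpace ℝ (Fin 2))‖ ^ 2)))) +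
          3 * (an₂ * ((32 * B₂ + 144 * B₁ + 128) * (β * (L : ℝ) ^ 2) / Λ ^ 3 * P₀ * (Kb₁ * ‖(WithLp.toLp 2 (fun j => 2 * π / L * ((![-v 1, v 0] : Fin 2 → ℤ) j : ℝ)) : EuclideanSpace ℝ (Fin 2))‖ + P₁ * ‖(WithLp.toLp 2 (fun j => 2 * π / L * ((![-v 1, v 0] : Fin 2 → ℤ) j : ℝ)) : EuclideanSpace ℝ (Fin 2))‖) + (16 * B₁ + 16) * (β * (L : ℝ) ^ 2) / Λ ^ 2 * (P₁ * ‖(WithLp.toLp 2 (fun j => 2 * π / L * ((![-v 1, v 0] : Fin 2 → ℤ) j : ℝ)) : EuclideanSpace ℝ (Fin 2))‖))) +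
          an₃ * ((16 * B₁ + 16) * (β * (L : ℝ) ^ 2) / Λ ^ 2 * P₀)) ≤
      A₀ * (4 / (s₂ * L)) ^ 3)
    (hr₃ : (1 / (β * (L : ℝ) ^ 2)) ^ 2 *
        (1 * ((64 * B₃ + 480 * B₂ + 1728 * B₁ + 1536) * (β * (L : ℝ) ^ 2) / Λ ^ 4 * P₀ * (Kb₁ * ‖(WithLp.toLp 2 (fun j => 2 * π / L * (v j : ℝ)) : EuclideanSpace ℝ (Fin 2))‖ + P₁ * ‖(WithLp.toLp 2 (fun j => 2 * π / L * (v j : ℝ)) : EuclideanSpace ℝ (Fin 2))‖) ^ 2 +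
        (32 * B₂ + 144 * B₁ + 128) * (β * (L : ℝ) ^ 2) / Λ ^ 3 * (P₁ * ‖(WithLp.toLp 2 (fun j => 2 * π / L * (v j : ℝ)) : EuclideanSpace ℝ (Fin 2))‖ * (2 * (Kb₁ * ‖(WithLp.toLp 2 (fun j => 2 * π / L * (v j : ℝ)) : EuclideanSpace ℝ (Fin 2))‖) + P₁ * ‖(WithLp.toLp 2 (fun j => 2 * π / L * (v j : ℝ)) : EuclideanSpace ℝ (Fin 2))‖)) +
        ((32 * B₂ + 144 * B₁ + 128) * (β * (L : ℝ) ^ 2) / Λ ^ 3 * P₀ * (Kb₂ * ‖(WithLp.toLp 2 (fun j => 2 * π / L * (v j : ℝ)) : EuclideanSpace ℝ (Fin 2))‖ ^ 2 + P₂ * ‖(WithLp.toLp 2 (fun j => 2 * π / L * (v j : ℝ)) : EuclideanSpace ℝ (Fin 2))‖ ^ 2) +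
          (16 * B₁ + 16) * (β * (L : ℝ) ^ 2) / Λ ^ 2 * (P₂ * ‖(WithLp.toLp 2 (fun j => 2 * π / L * (v j : ℝ)) : EuclideanSpace ℝ (Fin 2))‖ ^ 2))) +
          2 * (av₁ * ((32 * B₂ + 144 * B₁ + 128) * (β * (L : ℝ) ^ 2) / Λ ^ 3 * P₀ * (Kb₁ * ‖(WithLp.toLp 2 (fun j => 2 * π / L * (v j : ℝ)) : EuclideanSpace ℝ (Fin 2))‖ + P₁ * ‖(WithLp.toLp 2 (fun j => 2 * π / L * (v j : ℝ)) : EuclideanSpace ℝ (Fin 2))‖) + (16 * B₁ + 16) * (β * (L : ℝ) ^ 2) / Λ ^ 2 * (P₁ * ‖(WithLp.toLp 2 (fun j => 2 * π / L * (v j : ℝ)) : EuclideanSpace ℝ (Fin 2))‖))) +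
          av₂ * ((16 * B₁ + 16) * (β * (L : ℝ) ^ 2) / Λ ^ 2 * P₀)) ≤
      A₀ * (4 / (s₃ * L)) ^ 2)
    (hr₃' : (1 / (β * (L : ℝ) ^ 2)) ^ 2 *
        (1 * ((128 * B₄ + 1408 * B₃ + 7776 * B₂ + 27648 * B₁ + 24576) * (β * (L : ℝ) ^ 2) / Λ ^ 5 * P₀ * (Kb₁ * ‖(WithLp.toLp 2 (fun j => 2 * π / L * (v j : ℝ)) : EuclideanSpace ℝ (Fin 2))‖ + P₁ * ‖(WithLp.toLp 2 (fun j => 2 * π / L * (v j : ℝ)) : EuclideanSpace ℝ (Fin 2))‖) ^ 3 +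
        (64 * B₃ + 480 * B₂ + 1728 * B₁ + 1536) * (β * (L : ℝ) ^ 2) / Λ ^ 4 *
          (P₁ * ‖(WithLp.toLp 2 (fun j => 2 * π / L * (v j : ℝ)) : EuclideanSpace ℝ (Fin 2))‖ * (3 * (Kb₁ * ‖(WithLp.toLp 2 (fun j => 2 * π / L * (v j : ℝ)) : EuclideanSpace ℝ (Fin 2))‖) ^ 2 + 3 * (Kb₁ * ‖(WithLp.toLp 2 (fun j => 2 * π / L * (v j : ℝ)) : EuclideanSpace ℝ (Fin 2))‖) * (P₁ * ‖(WithLp.toLp 2 (fun j => 2 * π / L * (v j : ℝ)) : EuclideanSpace ℝ (Fin 2))‖) + (P₁ * ‖(WithLp.toLp 2 (fun j => 2 * π / L * (v j : ℝ)) : EuclideanSpace ℝ (Fin 2))‖) ^ 2)) +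
        3 * ((64 * B₃ + 480 * B₂ + 1728 * B₁ + 1536) * (β * (L : ℝ) ^ 2) / Λ ^ 4 * P₀ *
            ((Kb₁ * ‖(WithLp.toLp 2 (fun j => 2 * π / L * (v j : ℝ)) : EuclideanSpace ℝ (Fin 2))‖ + P₁ * ‖(WithLp.toLp 2 (fun j => 2 * π / L * (v j : ℝ)) : EuclideanSpace ℝ (Fin 2))‖) * (Kb₂ * ‖(WithLp.toLp 2 (fun j => 2 * π / L * (v j : ℝ)) : EuclideanSpace ℝ (Fin 2))‖ ^ 2 + P₂ * ‖(WithLp.toLp 2 (fun j => 2 * π / L * (v j : ℝ)) : EuclideanSpace ℝ (Fin 2))‖ ^ 2)) +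
          (32 * B₂ + 144 * B₁ + 128) * (β * (L : ℝ) ^ 2) / Λ ^ 3 *
            (Kb₁ * ‖(WithLp.toLp 2 (fun j => 2 * π / L * (v j : ℝ)) : EuclideanSpace ℝ (Fin 2))‖ * (P₂ * ‖(WithLp.toLp 2 (fun j => 2 * π / L * (v j : ℝ)) : EuclideanSpace ℝ (Fin 2))‖ ^ 2) + P₁ * ‖(WithLp.toLp 2 (fun j => 2 * π / L * (v j : ℝ)) : EuclideanSpace ℝ (Fin 2))‖ * (Kb₂ * ‖(WithLp.toLp 2 (fun j => 2 * π / L * (v j : ℝ)) : EuclideanSpace ℝ (Fin 2))‖ ^ 2) + P₁ * ‖(WithLp.toLp 2 (fun j => 2 * π / L * (v j : ℝ)) : EuclideanSpace ℝ (Fin 2))‖ * (P₂ * ‖(WithLp.toLp 2 (fun j => 2 * π / L * (v j : ℝ)) : EuclideanSpace ℝ (Fin 2))‖ ^ 2))) +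
        ((32 * B₂ + 144 * B₁ + 128) * (β * (L : ℝ) ^ 2) / Λ ^ 3 * P₀ * (Kb₃ * ‖(WithLp.toLp 2 (fun j => 2 * π / L * (v j : ℝ)) : EuclideanSpace ℝ (Fin 2))‖ ^ 3 + P₃ * ‖(WithLp.toLp 2 (fun j => 2 * π / L * (v j : ℝ)) : EuclideanSpace ℝ (Fin 2))‖ ^ 3) +
          (16 * B₁ + 16) * (β * (L : ℝ) ^ 2) / Λ ^ 2 * (P₃ * ‖(WithLp.toLp 2 (fun j => 2 * π / L * (v j : ℝ)) : EuclideanSpace ℝ (Fin 2))‖ ^ 3))) +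
          3 * (av₁ * ((64 * B₃ + 480 * B₂ + 1728 * B₁ + 1536) * (β * (L : ℝ) ^ 2) / Λ ^ 4 * P₀ * (Kb₁ * ‖(WithLp.toLp 2 (fun j => 2 * π / L * (v j : ℝ)) : EuclideanSpace ℝ (Fin 2))‖ + P₁ * ‖(WithLp.toLp 2 (fun j => 2 * π / L * (v j : ℝ)) : EuclideanSpace ℝ (Fin 2))‖) ^ 2 +
        (32 * B₂ + 144 * B₁ + 128) * (β * (L : ℝ) ^ 2) / Λ ^ 3 * (P₁ * ‖(WithLp.toLp 2 (fun j => 2 * π / L * (v j : ℝ)) : EuclideanSpace ℝ (Fin 2))‖ * (2 * (Kb₁ * ‖(WithLp.toLp 2 (fun j => 2 * π / L * (v j : ℝ)) : EuclideanSpace ℝ (Fin 2))‖) + P₁ * ‖(WithLp.toLp 2 (fun j => 2 * π / L * (v j : ℝ)) : EuclideanSpace ℝ (Fin 2))‖)) +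
        ((32 * B₂ + 144 * B₁ + 128) * (β * (L : ℝ) ^ 2) / Λ ^ 3 * P₀ * (Kb₂ * ‖(WithLp.toLp 2 (fun j => 2 * π / L * (v j : ℝ)) : EuclideanSpace ℝ (Fin 2))‖ ^ 2 + P₂ * ‖(WithLp.toLp 2 (fun j => 2 * π / L * (v j : ℝ)) : EuclideanSpace ℝ (Fin 2))‖ ^ 2) +
          (16 * B₁ + 16) * (β * (L : ℝ) ^ 2) / Λ ^ 2 * (P₂ * ‖(WithLp.toLp 2 (fun j => 2 * π / L * (v j : ℝ)) : EuclideanSpace ℝ (Fin 2))‖ ^ 2)))) +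
          3 * (av₂ * ((32 * B₂ + 144 * B₁ + 128) * (β * (L : ℝ) ^ 2) / Λ ^ 3 * P₀ * (Kb₁ * ‖(WithLp.toLp 2 (fun j => 2 * π / L * (v j : ℝ)) : EuclideanSpace ℝ (Fin 2))‖ + P₁ * ‖(WithLp.toLp 2 (fun j => 2 * π / L * (v j : ℝ)) : EuclideanSpace ℝ (Fin 2))‖) + (16 * B₁ + 16) * (β * (L : ℝ) ^ 2) / Λ ^ 2 * (P₁ * ‖(WithLp.toLp 2 (fun j => 2 * π / L * (v j : ℝ)) : EuclideanSpace ℝ (Fin 2))‖))) +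
          av₃ * ((16 * B₁ + 16) * (β * (L : ℝ) ^ 2) / Λ ^ 2 * P₀)) ≤
      A₀ * (4 / (s₃' * L)) ^ 3) :
    ∀ z₁ : TorusSite 1 (2 * M), ∑ z₂ : TorusSite 2 L,
        (1 + s₁ * |(((z₂ 0).valMinAbs : ℤ) : ℝ)| + s₁ * |(((z₂ 1).valMinAbs : ℤ) : ℝ)|) *
        ‖∑ q : TorusSite 1 (2 * M) × TorusSite 2 L, (torusChar q.1 z₁ * torusChar q.2 z₂) •
          ((((1 / (β * (L : ℝ) ^ 2) : ℝ) : ℂ) ^ 2 *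
            (Mf q * (sliceSymbolFnXi (β * (L : ℝ) ^ 2) 0 Λ Λ' (matsubaraFreq β M ⟨(q.1 0).val, ZMod.val_lt (q.1 0)⟩) (nambuXiCT L μ K' q.2) -
              sliceSymbolFnXi (β * (L : ℝ) ^ 2) 0 Λ Λ' (matsubaraFreq β M ⟨(q.1 0).val, ZMod.val_lt (q.1 0)⟩) (nambuXiCT L μ K q.2)))))‖ ≤
      Nt * (Real.sqrt (524288 * (1 / s₀ + 1) *
          ((1 + 2 * Real.sqrt 2 * s₁ / (s₂ * Real.sqrt ((v 0 : ℝ) ^ 2 + (v 1 : ℝ) ^ 2)) +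
              2 * Real.sqrt 2 * s₁ / (s₃' * Real.sqrt ((v 0 : ℝ) ^ 2 + (v 1 : ℝ) ^ 2))) ^ 2 *
            ((2 * Real.sqrt 2 / (s₂ * Real.sqrt ((v 0 : ℝ) ^ 2 + (v 1 : ℝ) ^ 2)) + 2) *
              (2 * Real.sqrt 2 / (s₃ * Real.sqrt ((v 0 : ℝ) ^ 2 + (v 1 : ℝ) ^ 2)) + 2))
            + (1 / s₁ + 1) ^ 2 / (1 + s₁ * R₀))) *
        Real.sqrt (24 * (L : ℝ) ^ 2 * Nsp) * A₀) := by
  classical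
  set c : ℝ := β * (L : ℝ) ^ 2 with hc_def
  have hc : 0 ≤ c := by positivity
  set c₀ : ℂ := (((1 / (β * (L : ℝ) ^ 2) : ℝ) : ℂ)) ^ 2 with hc₀
  have hc₀n : ‖c₀‖ = (1 / (β * (L : ℝ) ^ 2)) ^ 2 := by
    rw [hc₀, norm_pow, Complex.norm_real, Real.norm_eq_abs, abs_of_nonneg (by positivity)]
  set Ψ : TorusSite 1 (2 * M) × TorusSite 2 L → ℂ := fun q =>
    sliceSymbolFnXi (β * (L : ℝ) ^ 2) 0 Λ Λ' (matsubaraFreq β M ⟨(q.1 0).val, ZMod.val_lt (q.1 0)⟩) (nambuXiCT L μ K' q.2) -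
      sliceSymbolFnXi (β * (L : ℝ) ^ 2) 0 Λ Λ' (matsubaraFreq β M ⟨(q.1 0).val, ZMod.val_lt (q.1 0)⟩) (nambuXiCT L μ K q.2) with hΨ
  have hB10 : 0 ≤ B₁ := (abs_nonneg _).trans (hB₁ 0)
  have hB20 : 0 ≤ B₂ := (abs_nonneg _).trans (hB₂ 0)
  have hB30 : 0 ≤ B₃ := (abs_nonneg _).trans (hB₃ 0)
  have hB40 : 0 ≤ B₄ := (abs_nonneg _).trans (hB₄ 0)
  have hKb1 : 0 ≤ Kb₁ := le_trans (norm_nonneg _) (hb₁ 0)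
  have hKb2 : 0 ≤ Kb₂ := le_trans (norm_nonneg _) (hb₂ 0)
  have hKb3 : 0 ≤ Kb₃ := le_trans (norm_nonneg _) (hb₃ 0)
  have hP0 : 0 ≤ P₀ := (abs_nonneg _).trans (hv₀ 0)
  have hP1 : 0 ≤ P₁ := le_trans (norm_nonneg _) (hv₁ 0)
  have hP2 : 0 ≤ P₂ := le_trans (norm_nonneg _) (hv₂ 0)
  have hP3 : 0 ≤ P₃ := le_trans (norm_nonneg _) (hv₃ 0)
  -- propagator data: sup (everywhere)
  have hΨ0 : ∀ q, ‖Ψ q‖ ≤ (16 * B₁ + 16) * c / Λ ^ 2 * P₀ := fun q =>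
    norm_sliceSymbolTorusIncr_le (K := K) (K' := K') (β := β) (μ := μ) hΛ hΛΛ' hc hB₁ hv₀ q
  have hb0 : 0 ≤ (16 * B₁ + 16) * c / Λ ^ 2 * P₀ := by positivity
  have hsup : ∀ q, ‖c₀ * (Mf q * Ψ q)‖ ≤ ‖c₀‖ * ((16 * B₁ + 16) * c / Λ ^ 2 * P₀) := by
    intro q
    have h := norm_smul_mul_le_of_support c₀ Mf Ψ zero_le_one hb0 hM0 (fun x _ => hΨ0 x) q
    simpa only [one_mul] using h
  have hA' : ‖c₀‖ * ((16 * B₁ + 16) * c / Λ ^ 2 * P₀) ≤ A₀ := by rw [hc₀n]; exact hA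
  have hA₀ : 0 ≤ A₀ := le_trans (by positivity) hA'
  have hsupA : ∀ q, ‖c₀ * (Mf q * Ψ q)‖ ≤ A₀ := fun q => (hsup q).trans hA'
  -- generic space direction at order three (data everywhere)
  have hspace3 : ∀ (r : Fin 2 → ℤ) (a₁ a₂ a₃ : ℝ), 0 ≤ a₁ → 0 ≤ a₂ → 0 ≤ a₃ →
      (∀ q, ‖fwdDiff ((0 : TorusSite 1 (2 * M)), (fun j => ((r j : ℤ) : ZMod L))) Mf q‖ ≤ a₁) →
      (∀ q, ‖(fwdDiff ((0 : TorusSite 1 (2 * M)), (fun j => ((r j : ℤ) : ZMod L))))^[2] Mf q‖ ≤ a₂) →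
      (∀ q, ‖(fwdDiff ((0 : TorusSite 1 (2 * M)), (fun j => ((r j : ℤ) : ZMod L))))^[3] Mf q‖ ≤ a₃) →
      ∀ q, ‖(fwdDiff ((0 : TorusSite 1 (2 * M)), (fun j => ((r j : ℤ) : ZMod L))))^[3] (fun y => c₀ * (Mf y * Ψ y)) q‖ ≤
        ‖c₀‖ * (1 * ((128 * B₄ + 1408 * B₃ + 7776 * B₂ + 27648 * B₁ + 24576) * c / Λ ^ 5 * P₀ * (Kb₁ * ‖(WithLp.toLp 2 (fun j => 2 * π / L * (r j : ℝ)) : EuclideanSpace ℝ (Fin 2))‖ + P₁ * ‖(WithLp.toLp 2 (fun j => 2 * π / L * (r j : ℝ)) : EuclideanSpace ℝ (Fin 2))‖) ^ 3 +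
        (64 * B₃ + 480 * B₂ + 1728 * B₁ + 1536) * c / Λ ^ 4 *
          (P₁ * ‖(WithLp.toLp 2 (fun j => 2 * π / L * (r j : ℝ)) : EuclideanSpace ℝ (Fin 2))‖ * (3 * (Kb₁ * ‖(WithLp.toLp 2 (fun j => 2 * π / L * (r j : ℝ)) : EuclideanSpace ℝ (Fin 2))‖) ^ 2 + 3 * (Kb₁ * ‖(WithLp.toLp 2 (fun j => 2 * π / L * (r j : ℝ)) : EuclideanSpace ℝ (Fin 2))‖) * (P₁ * ‖(WithLp.toLp 2 (fun j => 2 * π / L * (r j : ℝ)) : EuclideanSpace ℝ (Fin 2))‖) + (P₁ * ‖(WithLp.toLp 2 (fun j => 2 * π / L * (r j : ℝ)) : EuclideanSpace ℝ (Fin 2))‖) ^ 2)) +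
        3 * ((64 * B₃ + 480 * B₂ + 1728 * B₁ + 1536) * c / Λ ^ 4 * P₀ *
            ((Kb₁ * ‖(WithLp.toLp 2 (fun j => 2 * π / L * (r j : ℝ)) : EuclideanSpace ℝ (Fin 2))‖ + P₁ * ‖(WithLp.toLp 2 (fun j => 2 * π / L * (r j : ℝ)) : EuclideanSpace ℝ (Fin 2))‖) * (Kb₂ * ‖(WithLp.toLp 2 (fun j => 2 * π / L * (r j : ℝ)) : EuclideanSpace ℝ (Fin 2))‖ ^ 2 + P₂ * ‖(WithLp.toLp 2 (fun j => 2 * π / L * (r j : ℝ)) : EuclideanSpace ℝ (Fin 2))‖ ^ 2)) +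
          (32 * B₂ + 144 * B₁ + 128) * c / Λ ^ 3 *
            (Kb₁ * ‖(WithLp.toLp 2 (fun j => 2 * π / L * (r j : ℝ)) : EuclideanSpace ℝ (Fin 2))‖ * (P₂ * ‖(WithLp.toLp 2 (fun j => 2 * π / L * (r j : ℝ)) : EuclideanSpace ℝ (Fin 2))‖ ^ 2) + P₁ * ‖(WithLp.toLp 2 (fun j => 2 * π / L * (r j : ℝ)) : EuclideanSpace ℝ (Fin 2))‖ * (Kb₂ * ‖(WithLp.toLp 2 (fun j => 2 * π / L * (r j : ℝ)) : EuclideanSpace ℝ (Fin 2))‖ ^ 2) + P₁ * ‖(WithLp.toLp 2 (fun j => 2 * π / L * (r j : ℝ)) : EuclideanSpace ℝ (Fin 2))‖ * (P₂ * ‖(WithLp.toLp 2 (fun j => 2 * π / L * (r j : ℝ)) : EuclideanSpace ℝ (Fin 2))‖ ^ 2))) +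
        ((32 * B₂ + 144 * B₁ + 128) * c / Λ ^ 3 * P₀ * (Kb₃ * ‖(WithLp.toLp 2 (fun j => 2 * π / L * (r j : ℝ)) : EuclideanSpace ℝ (Fin 2))‖ ^ 3 + P₃ * ‖(WithLp.toLp 2 (fun j => 2 * π / L * (r j : ℝ)) : EuclideanSpace ℝ (Fin 2))‖ ^ 3) +
          (16 * B₁ + 16) * c / Λ ^ 2 * (P₃ * ‖(WithLp.toLp 2 (fun j => 2 * π / L * (r j : ℝ)) : EuclideanSpace ℝ (Fin 2))‖ ^ 3))) +
          3 * (a₁ * ((64 * B₃ + 480 * B₂ + 1728 * B₁ + 1536) * c / Λ ^ 4 * P₀ * (Kb₁ * ‖(WithLp.toLp 2 (fun j => 2 * π / L * (r j : ℝ)) : EuclideanSpace ℝ (Fin 2))‖ + P₁ * ‖(WithLp.toLp 2 (fun j => 2 * π / L * (r j : ℝ)) : EuclideanSpace ℝ (Fin 2))‖) ^ 2 +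
        (32 * B₂ + 144 * B₁ + 128) * c / Λ ^ 3 * (P₁ * ‖(WithLp.toLp 2 (fun j => 2 * π / L * (r j : ℝ)) : EuclideanSpace ℝ (Fin 2))‖ * (2 * (Kb₁ * ‖(WithLp.toLp 2 (fun j => 2 * π / L * (r j : ℝ)) : EuclideanSpace ℝ (Fin 2))‖) + P₁ * ‖(WithLp.toLp 2 (fun j => 2 * π / L * (r j : ℝ)) : EuclideanSpace ℝ (Fin 2))‖)) +
        ((32 * B₂ + 144 * B₁ + 128) * c / Λ ^ 3 * P₀ * (Kb₂ * ‖(WithLp.toLp 2 (fun j => 2 * π / L * (r j : ℝ)) : EuclideanSpace ℝ (Fin 2))‖ ^ 2 + P₂ * ‖(WithLp.toLp 2 (fun j => 2 * π / L * (r j : ℝ)) : EuclideanSpace ℝ (Fin 2))‖ ^ 2) +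
          (16 * B₁ + 16) * c / Λ ^ 2 * (P₂ * ‖(WithLp.toLp 2 (fun j => 2 * π / L * (r j : ℝ)) : EuclideanSpace ℝ (Fin 2))‖ ^ 2)))) +
          3 * (a₂ * ((32 * B₂ + 144 * B₁ + 128) * c / Λ ^ 3 * P₀ * (Kb₁ * ‖(WithLp.toLp 2 (fun j => 2 * π / L * (r j : ℝ)) : EuclideanSpace ℝ (Fin 2))‖ + P₁ * ‖(WithLp.toLp 2 (fun j => 2 * π / L * (r j : ℝ)) : EuclideanSpace ℝ (Fin 2))‖) + (16 * B₁ + 16) * c / Λ ^ 2 * (P₁ * ‖(WithLp.toLp 2 (fun j => 2 * π / L * (r j : ℝ)) : EuclideanSpace ℝ (Fin 2))‖))) +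
          a₃ * ((16 * B₁ + 16) * c / Λ ^ 2 * P₀)) := by
    intro r a₁ a₂ a₃ ha₁ ha₂ ha₃ hM1 hM2 hM3' q
    exact norm_fwdDiff_iter_three_smul_mul_le_of_support _ c₀ Mf Ψ zero_le_one ha₁ ha₂ ha₃ hb0 (by positivity) (by positivity)
      (by positivity) hM0 hM1 hM2 hM3' (fun x _ => hΨ0 x)
      (fun x _ => norm_fwdDiff_one_space_sliceSymbolTorusIncr_le (K := K) (K' := K') (β := β) (μ := μ) hb₁ hv₀ hv₁ hΛ hΛΛ' hc hB₁ hB₂ r x)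
      (fun x _ => norm_fwdDiff_two_space_sliceSymbolTorusIncr_le (K := K) (K' := K') (β := β) (μ := μ) hb₁ hb₂ hv₀ hv₁ hv₂ hΛ hΛΛ' hc hB₁ hB₂ hB₃ r x)
      (fun x _ => norm_fwdDiff_three_space_sliceSymbolTorusIncr_le (K := K) (K' := K') (β := β) (μ := μ) hb₁ hb₂ hb₃ hv₀ hv₁ hv₂ hv₃
        hΛ hΛΛ' hc hB₁ hB₂ hB₃ hB₄ r x) q
  -- the direction `v` at order two
  have hspace2 : ∀ q, ‖(fwdDiff ((0 : TorusSite 1 (2 * M)), (fun j => ((v j : ℤ) : ZMod L))))^[2] (fun y => c₀ * (Mf y * Ψ y)) q‖ ≤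
        ‖c₀‖ * (1 * ((64 * B₃ + 480 * B₂ + 1728 * B₁ + 1536) * c / Λ ^ 4 * P₀ * (Kb₁ * ‖(WithLp.toLp 2 (fun j => 2 * π / L * (v j : ℝ)) : EuclideanSpace ℝ (Fin 2))‖ + P₁ * ‖(WithLp.toLp 2 (fun j => 2 * π / L * (v j : ℝ)) : EuclideanSpace ℝ (Fin 2))‖) ^ 2 +
        (32 * B₂ + 144 * B₁ + 128) * c / Λ ^ 3 * (P₁ * ‖(WithLp.toLp 2 (fun j => 2 * π / L * (v j : ℝ)) : EuclideanSpace ℝ (Fin 2))‖ * (2 * (Kb₁ * ‖(WithLp.toLp 2 (fun j => 2 * π / L * (v j : ℝ)) : EuclideanSpace ℝ (Fin 2))‖) + P₁ * ‖(WithLp.toLp 2 (fun j => 2 * π / L * (v j : ℝ)) : EuclideanSpace ℝ (Fin 2))‖)) +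
        ((32 * B₂ + 144 * B₁ + 128) * c / Λ ^ 3 * P₀ * (Kb₂ * ‖(WithLp.toLp 2 (fun j => 2 * π / L * (v j : ℝ)) : EuclideanSpace ℝ (Fin 2))‖ ^ 2 + P₂ * ‖(WithLp.toLp 2 (fun j => 2 * π / L * (v j : ℝ)) : EuclideanSpace ℝ (Fin 2))‖ ^ 2) +
          (16 * B₁ + 16) * c / Λ ^ 2 * (P₂ * ‖(WithLp.toLp 2 (fun j => 2 * π / L * (v j : ℝ)) : EuclideanSpace ℝ (Fin 2))‖ ^ 2))) +
          2 * (av₁ * ((32 * B₂ + 144 * B₁ + 128) * c / Λ ^ 3 * P₀ * (Kb₁ * ‖(WithLp.toLp 2 (fun j => 2 * π / L * (v j : ℝ)) : EuclideanSpace ℝ (Fin 2))‖ + P₁ * ‖(WithLp.toLp 2 (fun j => 2 * π / L * (v j : ℝ)) : EuclideanSpace ℝ (Fin 2))‖) + (16 * B₁ + 16) * c / Λ ^ 2 * (P₁ * ‖(WithLp.toLp 2 (fun j => 2 * π / L * (v j : ℝ)) : EuclideanSpace ℝ (Fin 2))‖))) +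
          av₂ * ((16 * B₁ + 16) * c / Λ ^ 2 * P₀)) := by
    intro q
    exact norm_fwdDiff_iter_two_smul_mul_le_of_support _ c₀ Mf Ψ zero_le_one hav₁ hav₂ hb0 (by positivity) (by positivity)
      hM0 hMv₁ hMv₂ (fun x _ => hΨ0 x)
      (fun x _ => norm_fwdDiff_one_space_sliceSymbolTorusIncr_le (K := K) (K' := K') (β := β) (μ := μ) hb₁ hv₀ hv₁ hΛ hΛΛ' hc hB₁ hB₂ v x)
      (fun x _ => norm_fwdDiff_two_space_sliceSymbolTorusIncr_le (K := K) (K' := K') (β := β) (μ := μ) hb₁ hb₂ hv₀ hv₁ hv₂ hΛ hΛΛ' hc hB₁ hB₂ hB₃ v x) q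
  -- `Pi.single i 1` as the reduction of the integer vector `Pi.single i 1`
  have hsingle : ∀ i : Fin 2, (Pi.single i (1 : ZMod L) : TorusSite 2 L) = fun j => (((Pi.single i (1 : ℤ) : Fin 2 → ℤ) j : ℤ) : ZMod L) := by
    intro i; funext j
    by_cases h : j = i
    · subst h; simp
    · simp [h]
  -- assemble via the mixed master lemma
  intro z₁
  refine sliceCharSumWt_sectional_le_of_mixed_data c₀ Mf Ψ v hv hs₀ hs₁ hs₂ hs₃ hs₃' hR₀ hA₀ hsuppT hsuppS hsupA ?_ ?_ ?_ ?_ z₁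
  · intro q i
    rw [hsingle i]
    refine (hspace3 (Pi.single i (1 : ℤ)) (ae₁ i) (ae₂ i) (ae₃ i) (hae₁ i) (hae₂ i) (hae₃ i)
      (fun q => by rw [← hsingle i]; exact hMe₁ q i) (fun q => by rw [← hsingle i]; exact hMe₂ q i)
      (fun q => by rw [← hsingle i]; exact hMe₃ q i) q).trans ?_
    rw [hc₀n]; exact hr₁ i
  · intro q
    refine (hspace3 (![-v 1, v 0]) an₁ an₂ an₃ han₁ han₂ han₃ hMn₁ hMn₂ hMn₃ q).trans ?_
    rw [hc₀n]; exact hr₂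
  · intro q
    refine (hspace2 q).trans ?_
    rw [hc₀n]; exact hr₃
  · intro q
    refine (hspace3 v av₁ av₂ av₃ hav₁ hav₂ hav₃ hMv₁ hMv₂ hMv₃ q).trans ?_
    rw [hc₀n]; exact hr₃'

end Pair

end Summit.HubbardSuperconductivity.HubbardSuperconductivity.Theorems.TorusFourierL2

end
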